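import Summits.AtomisticToContinuum.HydrodynamicLimit.Theses.InformationPercolationEngine
import Summits.AtomisticToContinuum.HydrodynamicLimit.Theorems.InformationPercolationEngineSpectralContractionR

/-!
# Route InformationPercolationEngine — the `Assembly` frame (item stmt-AtomisticToContinuum-17869, rev 16): reductions

`InformationPercolationEngine.Assembly` (rev 16 of the route) is the frame statement
`KickFairRelEquilibriumMeso → SpectralContractionR → PercolationClosesChaos → CollisionRate → LocalSecondLaw →
HydrodynamicLimit` — the Lean line of the route's deciding theorem `InformationPercolationEngine.closes`
(`hC (hP hK hS) hR hL`) with the kinetic dock `ChaosClosesEuler` (crux stmt-AtomisticToContinuum-15141,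
`ContactChaos → CollisionRate → LocalSecondLaw → ⟨packing-guarded conjunct⟩`) REMOVED from the antecedents.

This file records, sorry-free and against the live route module, the pure-logic facts that pin the item to the
ledger's other statements (the pattern of `OneFlightGossipEngineAssemblyDock.lean`, stmt-17616, and
`JParityClosureAssemblyReduction.lean`, stmt-17595):

* `informationPercolationEngine_assembly_iff_frame` — the engine crux `PercolationClosesChaos` enters only through its
  output: `Assembly ↔ (KickFairRelEquilibriumMeso → SpectralContractionR → ContactChaos → CollisionRate →
  LocalSecondLaw → HydrodynamicLimit)`;
* `informationPercolationEngine_assembly_iff_dock` — `Assembly ↔ (KickFairRelEquilibriumMeso → SpectralContractionR →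
  ChaosClosesEuler)`: the item IS the dock with the two engine inputs as idle extra antecedents (the dock's conclusion is
  the sub-problem decl `_root_.HydrodynamicLimit` by `δ`-unfolding since the statement re-type p126922);
* `informationPercolationEngine_assembly_iff_dock'` — with crux 3 discharged in-tree
  (`Cruxes.SpectralContractionR.SwapSymmetrisation.SpectralContractionR_proof`, which the gate cannot render as a
  `_holds` link in the route file for an import cycle, but which a Theorems file may import):
  `Assembly ↔ (KickFairRelEquilibriumMeso → ChaosClosesEuler)`;
* `informationPercolationEngine_assembly_of_chaosClosesEuler` — the closing recipe: the item follows from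
  `hC : ChaosClosesEuler` by `fun hK hS hP hR hL => hC (hP hK hS) hR hL` (the planner's `assemblyR_of_dock`), so it closes
  in one line the moment `ChaosClosesEuler_holds` is rendered;
* `informationPercolationEngine_chaosClosesEuler_of_assembly` — conversely, GIVEN the mechanism crux
  `KickFairRelEquilibriumMeso` (stmt-15177), a proof of the item is a proof of the dock;
* `informationPercolationEngine_contactChaos_of_engine` / `informationPercolationEngine_statement_of_cruxes` /
  `informationPercolationEngine_statement_of_assembly` — the `closes` chain with `hS` discharged (four open cruxes ⇒ the
  Statement), and the frame standing in for the dock binder;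
* `informationPercolationEngine_assembly_of_hydrodynamicLimit`, `informationPercolationEngine_not_assembly_iff`,
  `informationPercolationEngine_not_hydrodynamicLimit_of_not_assembly` — the shape of a refutation: the frame is implied
  by the sub-problem Statement itself, so `¬ Assembly` is the conjunction of the five antecedents with
  `¬ HydrodynamicLimit` and would refute the summit conjunct; the item cannot die by a counterexample, only as misstated.

Nothing here claims mathematical content beyond bookkeeping.  The dock itself (Březina–Feireisl relative energy of the
mollified empirical fields against the classical hard-sphere Euler solution, fed by chaos at contact, the Enskog rate and
an entropy inequality) is crux stmt-AtomisticToContinuum-15141 with its own line (`Cruxes/ChaosClosesEuler/Lines/Sketch.lean`);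
that line's lead records (`Cruxes/ChaosClosesEuler/NOTES.md` §B2–§B4, §D) that a relative-energy dock consumes neither the
same-time chaos `ContactChaos` (stmt-13477) nor the unclamped `LocalSecondLaw` (stmt-13081) and needs tail / cap /
rigidity inputs that are not among this frame's antecedents — so no argument on file derives the frame from its five
antecedents without proving the dock as typed.  prover-pitem-stmt-AtomisticToContinuum-17869-0.
-/

namespace Summit.AtomisticToContinuum.HydrodynamicLimit.Theorems

open Summit.AtomisticToContinuum.HydrodynamicLimit.Theses
open Summit.AtomisticToContinuum.HydrodynamicLimit.Cruxes.SpectralContractionR.SwapSymmetrisation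
  (SpectralContractionR_proof)

/-! ### The frame is the dock with idle antecedents -/

/-- **The engine enters the frame only through its output.** `Assembly` (stmt-AtomisticToContinuum-17869) is
equivalent to the same chain with the engine crux `PercolationClosesChaos :=
KickFairRelEquilibriumMeso → SpectralContractionR → ContactChaos` replaced by its output `ContactChaos`
(stmt-13477): forward, feed `Assembly` the constant engine `fun _ _ => hCC`; backward, run the engine on `hK, hS`.
[folklore] -/
theorem informationPercolationEngine_assembly_iff_frame :
    InformationPercolationEngine.Assembly ↔
      (InformationPercolationEngine.KickFairRelEquilibriumMeso → InformationPercolationEngine.SpectralContractionR →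
        InformationPercolationEngine.ContactChaos → InformationPercolationEngine.CollisionRate →
          InformationPercolationEngine.LocalSecondLaw → _root_.HydrodynamicLimit) :=
  ⟨fun hA hK hS hCC hR hL => hA hK hS (fun _ _ => hCC) hR hL,
    fun hB hK hS hP hR hL => hB hK hS (hP hK hS) hR hL⟩

/-- **`Assembly` is `crux 2 → crux 3 → Dock`.** The rev-16 frame statement of route InformationPercolationEngine
(stmt-AtomisticToContinuum-17869) is equivalent to
`KickFairRelEquilibriumMeso → SpectralContractionR → ChaosClosesEuler` (stmt-15177 → stmt-13913 → stmt-15141):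
the dock's conclusion is, by `δ`-unfolding, the sub-problem decl `_root_.HydrodynamicLimit` (statement re-type
p126922), and the engine crux is interchangeable with its output (`informationPercolationEngine_assembly_iff_frame`).
So the item carries exactly the content of the dock, with the two engine inputs as idle extra antecedents. [folklore] -/
theorem informationPercolationEngine_assembly_iff_dock :
    InformationPercolationEngine.Assembly ↔
      (InformationPercolationEngine.KickFairRelEquilibriumMeso → InformationPercolationEngine.SpectralContractionR →
        InformationPercolationEngine.ChaosClosesEuler) :=
  ⟨fun hA hK hS hCC hR hL => hA hK hS (fun _ _ => hCC) hR hL,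
    fun hB hK hS hP hR hL => hB hK hS (hP hK hS) hR hL⟩

/-- **`Assembly` is `crux 2 → Dock`, crux 3 being proved.** `SpectralContractionR` (stmt-13913) is discharged in
the tree by `Cruxes.SpectralContractionR.SwapSymmetrisation.SpectralContractionR_proof` (`λ₂² ≤ 1/4 < 1/2`); feeding
it in, the frame is equivalent to `KickFairRelEquilibriumMeso → ChaosClosesEuler` (stmt-15177 → stmt-15141).
[folklore] -/
theorem informationPercolationEngine_assembly_iff_dock' :
    InformationPercolationEngine.Assembly ↔
      (InformationPercolationEngine.KickFairRelEquilibriumMeso → InformationPercolationEngine.ChaosClosesEuler) :=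
  ⟨fun hA hK => informationPercolationEngine_assembly_iff_dock.mp hA hK SpectralContractionR_proof,
    fun hB => informationPercolationEngine_assembly_iff_dock.mpr fun hK _ => hB hK⟩

/-- **The dock closes the frame** (the closing recipe of stmt-AtomisticToContinuum-17869; the planner's
`assemblyR_of_dock`): from `hC : ChaosClosesEuler` (stmt-15141) the item follows by
`fun hK hS hP hR hL => hC (hP hK hS) hR hL` — run the engine, dock its output. Once the gate renders
`InformationPercolationEngine.ChaosClosesEuler_holds`, `informationPercolationEngine_assembly_of_chaosClosesEuler
ChaosClosesEuler_holds` closes the item. [folklore] -/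
theorem informationPercolationEngine_assembly_of_chaosClosesEuler
    (hC : InformationPercolationEngine.ChaosClosesEuler) : InformationPercolationEngine.Assembly :=
  informationPercolationEngine_assembly_iff_dock.mpr fun _ _ => hC

/-- **Given the mechanism crux, the frame IS the dock**: `KickFairRelEquilibriumMeso → Assembly → ChaosClosesEuler`
(crux 3 discharged by `SpectralContractionR_proof`). Together with
`informationPercolationEngine_assembly_of_chaosClosesEuler`: modulo crux 2 (stmt-15177) the item has no content of its
own besides crux stmt-15141 — any proof of the item that does not REFUTE crux 2 is a proof of the dock. [folklore] -/
theorem informationPercolationEngine_chaosClosesEuler_of_assembly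
    (hK : InformationPercolationEngine.KickFairRelEquilibriumMeso) (hA : InformationPercolationEngine.Assembly) :
    InformationPercolationEngine.ChaosClosesEuler :=
  informationPercolationEngine_assembly_iff_dock'.mp hA hK

/-! ### The `closes` chain with crux 3 discharged -/

/-- **The engine's output from cruxes 2 and 4 alone**: `KickFairRelEquilibriumMeso → PercolationClosesChaos →
ContactChaos`, the middle input `SpectralContractionR` being the proved `SpectralContractionR_proof` (the route file
keeps `hS` as a binder of `closes` only because its proof module imports the route file). [folklore] -/
theorem informationPercolationEngine_contactChaos_of_engine
    (hK : InformationPercolationEngine.KickFairRelEquilibriumMeso)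
    (hP : InformationPercolationEngine.PercolationClosesChaos) : InformationPercolationEngine.ContactChaos :=
  hP hK SpectralContractionR_proof

/-- **The route's deciding chain over its four OPEN cruxes**: `KickFairRelEquilibriumMeso` (15177),
`PercolationClosesChaos` (15178), `CollisionRate` (13481), `LocalSecondLaw` (13081) and the dock `ChaosClosesEuler`
(15141) imply the sub-problem Statement — `InformationPercolationEngine.closes` with its `hS` binder discharged by
`SpectralContractionR_proof`. [folklore] -/
theorem informationPercolationEngine_statement_of_cruxes
    (hK : InformationPercolationEngine.KickFairRelEquilibriumMeso)
    (hP : InformationPercolationEngine.PercolationClosesChaos) (hR : InformationPercolationEngine.CollisionRate)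
    (hL : InformationPercolationEngine.LocalSecondLaw) (hC : InformationPercolationEngine.ChaosClosesEuler) :
    _root_.HydrodynamicLimit :=
  InformationPercolationEngine.closes hK SpectralContractionR_proof hP hR hL hC

/-- **The frame can stand in for the dock binder of `closes`**: given the four open non-dock cruxes, `Assembly`
yields the Statement (modus ponens with `hS` discharged) — so a proof of the item would make the route's deciding
theorem fire without stmt-15141. [folklore] -/
theorem informationPercolationEngine_statement_of_assembly (hA : InformationPercolationEngine.Assembly)
    (hK : InformationPercolationEngine.KickFairRelEquilibriumMeso)
    (hP : InformationPercolationEngine.PercolationClosesChaos) (hR : InformationPercolationEngine.CollisionRate)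
    (hL : InformationPercolationEngine.LocalSecondLaw) : _root_.HydrodynamicLimit :=
  hA hK SpectralContractionR_proof hP hR hL

/-! ### The shape of a refutation -/

/-- **The Statement implies the frame** (drop all five antecedents): so the item is consistent with everything the
summit conjunct is consistent with, and cannot be refuted short of refuting `HydrodynamicLimit`. [folklore] -/
theorem informationPercolationEngine_assembly_of_hydrodynamicLimit (h : _root_.HydrodynamicLimit) :
    InformationPercolationEngine.Assembly :=
  fun _ _ _ _ _ => h

/-- **What `¬ Assembly` would mean.** The frame is a closed implication between the route's cruxes and the summit
conjunct, so its negation is the conjunction of the five antecedents with `¬ HydrodynamicLimit`: a disprover would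
have to PROVE kicks-fair-given-the-mesoscopic-past, the percolation engine, the Enskog rate and the local second law
(three of them open problems) AND refute the packing-guarded hydrodynamic limit of hard spheres. [folklore] -/
theorem informationPercolationEngine_not_assembly_iff :
    ¬ InformationPercolationEngine.Assembly ↔
      InformationPercolationEngine.KickFairRelEquilibriumMeso ∧ InformationPercolationEngine.SpectralContractionR ∧
        InformationPercolationEngine.PercolationClosesChaos ∧ InformationPercolationEngine.CollisionRate ∧
          InformationPercolationEngine.LocalSecondLaw ∧ ¬ _root_.HydrodynamicLimit := by
  rw [show InformationPercolationEngine.Assembly ↔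
      (InformationPercolationEngine.KickFairRelEquilibriumMeso → InformationPercolationEngine.SpectralContractionR →
        InformationPercolationEngine.PercolationClosesChaos → InformationPercolationEngine.CollisionRate →
          InformationPercolationEngine.LocalSecondLaw → _root_.HydrodynamicLimit) from Iff.rfl,
    Classical.not_imp, Classical.not_imp, Classical.not_imp, Classical.not_imp, Classical.not_imp]

/-- **A refutation of the frame refutes the summit conjunct** (contrapositive of
`informationPercolationEngine_assembly_of_hydrodynamicLimit`). [folklore] -/
theorem informationPercolationEngine_not_hydrodynamicLimit_of_not_assembly
    (h : ¬ InformationPercolationEngine.Assembly) : ¬ _root_.HydrodynamicLimit :=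
  fun H => h (informationPercolationEngine_assembly_of_hydrodynamicLimit H)

end Summit.AtomisticToContinuum.HydrodynamicLimit.Theorems
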